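import Literature.MathematicalPhysics.QuantumFieldTheory.Balaban1983to89.B9SitePinBlockCounts
import Literature.MathematicalPhysics.QuantumFieldTheory.Balaban1983to89.B9CoReadingCoordsS
import Literature.MathematicalPhysics.QuantumFieldTheory.Balaban1983to89.B6Partition118KLevelTorusBinders
import Literature.MathematicalPhysics.QuantumFieldTheory.Balaban1983to89.B6Cover236QbigOverlapV1
import Literature.MathematicalPhysics.QuantumFieldTheory.Balaban1983to89.Node00.OpsYLocalInverse

/-!
# `Balaban1983to89.B9WalkLettersCoordsS` — [B9] Thm 3.7 pp. 408–410 (the random walk (3.79)∕(3.90)) and [4] (2.36)–(2.39) p. 229: THE STATIC LETTERS OF THE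
# SITE-SECTOR WALK AT def-Y's MEMBERS, PART 1 — the partition of unity `h_□` read on the coordinate carrier `XSK`, the cube domains `□̃(c)` and their
# block sets `S_□`, the local inverse `G′_□(U)` as a coordinate model, and the U-INDEPENDENT static facts `|h_□| ≤ 1`, «supp h_□ meets only blocks of S_□»,
# the member-uniform overlap count `Σ_□ 1_{S_□}(y) ≤ N` (piece W-a, FILE C-1 of node00-def-Y's `W-a-DESIGN.md`)

T. Bałaban, *Propagators for lattice gauge theories in a background field*, Commun. Math. Phys. **99** (1985) 389–434 [`Balaban1985BackgroundPropagators`,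
"B9"]; [4] = T. Bałaban, *Propagators and renormalization transformations for lattice gauge theories. II*, Commun. Math. Phys. **96** (1984) 223–250
[`Balaban1984PropagatorsII`].  statement-level skeleton of published theorems with citation tags; proofs where landed; nothing here is a claim about
the Yang–Mills mass gap.

THE PRINT.  p. 408: *«We take a family 𝒟_j of cubes □ … The family 𝒟 is a partition of the lattice T. We take the partition of unity {h_□} defined at
the end of Sect. A in [4]. We have Σ_{□∈𝒟} h_□² = 1»*; p. 409 (3.87) `G′₀ = Σ_□ h_□G′_□h_□`; p. 410: *«A propagator G′_□ depends on U restricted to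
Ω₀(□) ⊂ □̃⁵»*; the cubes □̃ overlap finitely often ([4] p. 235).

THE POINT (the N06 certificate, dag-n06-d; node00-def-Y `W-a-DESIGN.md` q1–q4).  The stage-11 certificate of `Dag.B9_main` (edition 26, p604985) displays
the Theorem-3.7 walk letters `𝔬 : ∀ x, B9Thm37Whole.Ops (geo9Y x) (bg9Y …) (XSK …) (XSK …) (ι x)` with their U-INDEPENDENT static binders
`hst : StaticOK (𝔬 x) …`, `hκ`, `hrd`, `hloc`, `hcnt*` (≈ 45 binders with the A-side twins).  Piece W-a instantiates them at def-Y's genuine objects: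
FILE A = def-Y's `Node00.OpsYLocalInverse` (`GsqY`, `padDeltaY`, locality; landed p605048), FILE B = the `P_□ ∕ C_□` letters, FILE C (this seat) =
the coordinate models + the `Ops` record + the static theorems.  THIS FILE is FILE C, part 1 — everything that needs only FILE A and the landed
cube ∕ partition geometry:
* §1 the letters at a member `x` with a block map `bI` on fine bonds (the certificate's pins `hlev hβI hβ1 hbI0`): `cubeBlksY x c = QbigT …` (the blocks
  of `□̃(c)`, r03's `B6Partition118KLevelTorusCentral.QbigT` at the member's `M_h ≥ 1`, `P ≥ 4`), `cubeDomY x c` (its sites = the domain of `G′_□`),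
  `SblkY x bI c` (print's `S_□`: the index bonds the sites of `□̃(c)` are pinned to — the certificate's block of a site is `sIK bI`), `hWalkY x c : XSK → ℝ`
  (`h_□` read on the coordinate carrier through the site component), `gsqcoS x b B cfg parS bI c` (the coordinate model of `G′_□(U) = GsqY … (cubeDomY x c)`,
  def-Y's `GcoS` of FILE A's letter — `(η²·c_R)•coordOpK`, the scaling of the pinned `Gp`);
* §2 the static facts: ★ `abs_hWalkY_le_one` (`StaticOK.hh ∕ hhY`), ★ `blkSK_mem_SblkY_of_hWalkY_ne_zero` (`StaticOK.hS ∕ hSY`: `h_□ ≠ 0` at a point ⟹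
  its block lies in `S_□`; r03's `blkOf_mem_QT_of_hT_ne_zero` + `QT ⊆ QbigT`), ★★ `sum_indicator_SblkY_le` (`StaticOK.cnt` with the NAMED member-uniform
  count `walkCntY = 3·9^{d+1}·N₁` above the NAMED threshold `walkCntM₀Y`: a block pinned to `y` lies within block distance 1 of `β y` (n06-l
  `distB_blkOf_le_one_of_sIK`, 1-faithfulness), there are `≤ N₁` such blocks (n06-l `exists_card_nearBlocks_le`), each lies in `≤ 3·9^{d+1}` sets `QbigT □`
  (r03 `card_filter_mem_QbigT_le`)), `sum_hWalkY_sq` (`Σ_□ h_□² = 1` on `XSK`), ★ `gsqcoS_apply_eq_zero_off` (`G′_□` kills inputs and outputs off `□̃(c)` —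
  FILE A's `GsqY_apply_eq_zero ∕ GsqY_mul_cubeProjY` through the model; the support half of `Locality`).
HONEST SCOPE.  Definitions with bodies + bookkeeping theorems; nothing of [B9] asserted; COUNT-NEUTRAL; N06 NOT discharged; the `Ops` record itself
(FILE C-2) waits for FILE B's `P_□ ∕ C_□ ∕ Leibniz` letters and FILE A-1's `AgreeY`.  One finite 𝕋⁴ programme at fixed `ε` — NOT continuum, NOT OS, NOT
the mass gap ∕ Clay.  Cell `pub-ymgap` (HUMAN RULING D-0062), node N06 [B9], seat `pub-ymgap-dag-n06-d` (g10), 2026-08-28.  NEW file.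
-/

noncomputable section

namespace Literature.MathematicalPhysics.QuantumFieldTheory.Balaban1983to89.B9WalkLettersCoordsS

open Node00
open B6KLevelCensusIndexV1 (KIdx)
open B6Geom246MultiLevelBox (bset blkOf)
open B6GlobalChartV1 (blkV1)
open B6Ineq2142KLevelV1 (lvl β)
open B6Cover236MultiLevelBlocks (cubes)
open B6Partition118KLevelTorus (hT abs_hT_le_one sum_hT_sq)
open B6Partition118KLevelTorusCentral (QT QbigT QT_subset_QbigT blkOf_mem_QT_of_hT_ne_zero)
open B6Cover236QbigOverlapV1 (card_filter_mem_QbigT_le)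
open B9Thm37CubeCoverCommutators (hTY one_le_Mh_and_P)
open B9CoReadingCoords (coordOpK)
open B9CoReadingCoordsS (XSK blkSK sIK GcoS)
open B9Ineq349SiteComposite (distB)
open B9SitePinBlockCounts (exists_card_nearBlocks_le distB_blkOf_le_one_of_sIK)
open B9PinMembersKLevelV1 (MemberY geo9Y bg9Y)
open Node00.OpsYLocalInverse (GsqY GsqY_apply_eq_zero)

variable {d ℓ : ℕ} {hd : 1 ≤ d + 1} {hL : Odd (ℓ + 1) ∧ 1 < ℓ + 1} {b₀ b₁ : ℝ} {Mstar : ℕ}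
variable {κ : Type}

/-! ## §1 The static letters of the walk at a member -/

section Letters

variable (x : MemberY d ℓ hd hL b₀ b₁ Mstar)

/-- `M_h ≥ 2` at a member (`KIdx.hM8`). [cite: Balaban1984PropagatorsII, (2.36) p.229, bookkeeping] -/
theorem two_le_Mh : 2 ≤ x.toKIdx.Mh := le_trans (by norm_num) x.toKIdx.hM8

/-- `P ≥ 4` in every direction at a member (`KIdx.hP5`). [cite: Balaban1984PropagatorsII, (2.36) p.229, bookkeeping] -/
theorem four_le_P : ∀ μ, 4 ≤ x.toKIdx.P' μ := fun μ => le_trans (by norm_num) (x.toKIdx.hP5 μ)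

/-- `R ≥ 2L` at a member (`KIdx.hR2 : 2L² ≤ R`). [cite: Balaban1984PropagatorsII, (2.36) p.229, bookkeeping] -/
theorem two_L_le_R : 2 * (ℓ + 1) ≤ x.toKIdx.R :=
  le_trans (Nat.mul_le_mul_left 2 (Nat.le_self_pow two_ne_zero (ℓ + 1))) x.toKIdx.hR2

/-- **the blocks of the enlarged cube `□̃(c)`** (r03's `QbigT` at the member). [cite: Balaban1985BackgroundPropagators, p.408 («□̃»); Balaban1984PropagatorsII, (2.36) p.229, p.235] -/
def cubeBlksY (c : ↥(cubes x.toKIdx.D.toDomains)) : Finset (BlkY x.toKIdx) :=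
  QbigT x.toKIdx.D (one_le_Mh_and_P x.toKIdx).1 (four_le_P x) c

/-- **the sites of `□̃(c)`** — the domain of the local inverse `G′_□`. [cite: Balaban1985BackgroundPropagators, p.410 («G′_□ depends on U restricted to Ω₀(□) ⊂ □̃⁵»), p.408] -/
def cubeDomY (c : ↥(cubes x.toKIdx.D.toDomains)) : Finset (SiteY x.toKIdx) :=
  Finset.univ.filter fun z => blkOf x.toKIdx.D.toDomains z ∈ cubeBlksY x c

/-- **print's `S_□` in the certificate's block language**: the index bonds the sites of `□̃(c)` are pinned to under `sIK bI`. [cite: Balaban1985BackgroundPropagators, (3.87) p.409, p.408; Balaban1984PropagatorsII, (2.45) p.231] -/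
def SblkY (bI : FBondY x.toKIdx → IBondY x.toKIdx) (c : ↥(cubes x.toKIdx.D.toDomains)) : Finset (IBondY x.toKIdx) :=
  (cubeDomY x c).image (sIK x.toKIdx bI)

/-- **the partition function `h_□` on the coordinate carrier `XSK`** (read through the site component). [cite: Balaban1985BackgroundPropagators, p.408 («Σ_□ h_□² = 1»); Balaban1984PropagatorsII, (2.36) p.229] -/
def hWalkY (c : ↥(cubes x.toKIdx.D.toDomains)) : XSK κ x.toKIdx → ℝ := fun p => hTY x.toKIdx c p.1

/-- **the coordinate model of the local inverse `G′_□(U)`**: def-Y's site model `GcoS` of FILE A's letter `GsqY … (cubeDomY x c)`.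
[cite: Balaban1985BackgroundPropagators, (3.87) p.409, p.410; Balaban1984PropagatorsII, (2.37) p.229] -/
def gsqcoS [Fintype κ] {𝔸 : Type} [NormedRing 𝔸] [NormedAlgebra ℂ 𝔸] [CompleteSpace 𝔸] [FiniteDimensional ℝ 𝔸] (b : Module.Basis κ ℝ 𝔸)
    (B : B9.Backgrounds)
    (cfg : B.Cfg → CfgY 𝔸 x.toKIdx) (parS : SiteParY 𝔸 x.toKIdx) (c : ↥(cubes x.toKIdx.D.toDomains)) (U : B.Cfg) :
    Module.End ℝ (XSK κ x.toKIdx → ℝ) :=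
  GcoS x.toKIdx b B cfg (GsqY x.toKIdx parS (cubeDomY x c)) U

end Letters

/-! ## §2 The named member-uniform overlap count -/

section Count

open Classical in
/-- **the `M`-threshold of the overlap count** (n06-l's `exists_card_nearBlocks_le`, named). [cite: Balaban1984PropagatorsII, Lemma 2.1 (2.61) p.234, (2.45)–(2.46) p.231, bookkeeping] -/
def walkCntM₀Y (d ℓ : ℕ) (hd : 1 ≤ d + 1) (hL : Odd (ℓ + 1) ∧ 1 < ℓ + 1) (b₀ b₁ : ℝ) (Mstar : ℕ) : ℝ :=
  (exists_card_nearBlocks_le (d := d) (ℓ := ℓ) (hd := hd) (hL := hL) (b₀ := b₀) (b₁ := b₁) (Mstar := Mstar)).choose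

open Classical in
/-- **the member-uniform bound on the number of blocks within block distance 1 of a block**, named. [cite: Balaban1984PropagatorsII, Lemma 2.1 (2.61) p.234, bookkeeping] -/
def nearBlkCntY (d ℓ : ℕ) (hd : 1 ≤ d + 1) (hL : Odd (ℓ + 1) ∧ 1 < ℓ + 1) (b₀ b₁ : ℝ) (Mstar : ℕ) : ℝ :=
  (exists_card_nearBlocks_le (d := d) (ℓ := ℓ) (hd := hd) (hL := hL) (b₀ := b₀) (b₁ := b₁) (Mstar := Mstar)).choose_spec.choose

/-- **print's `N` of «the cubes □̃ overlap finitely often»** in the certificate's block language: `3·9^{d+1}·N₁`. [cite: Balaban1984PropagatorsII, p.235, (2.36) p.229, bookkeeping] -/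
def walkCntY (d ℓ : ℕ) (hd : 1 ≤ d + 1) (hL : Odd (ℓ + 1) ∧ 1 < ℓ + 1) (b₀ b₁ : ℝ) (Mstar : ℕ) : ℝ :=
  3 * 9 ^ (d + 1) * nearBlkCntY d ℓ hd hL b₀ b₁ Mstar

/-- `N₁ ≥ 0`. [cite: Balaban1984PropagatorsII, Lemma 2.1 (2.61) p.234, bookkeeping] -/
theorem nearBlkCntY_nonneg : 0 ≤ nearBlkCntY d ℓ hd hL b₀ b₁ Mstar :=
  (exists_card_nearBlocks_le (d := d) (ℓ := ℓ) (hd := hd) (hL := hL) (b₀ := b₀) (b₁ := b₁) (Mstar := Mstar)).choose_spec.choose_spec.1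

/-- the defining property of the named count above the named threshold. [cite: Balaban1984PropagatorsII, Lemma 2.1 (2.61) p.234, bookkeeping] -/
theorem card_nearBlocks_le (x : MemberY d ℓ hd hL b₀ b₁ Mstar) (hM : walkCntM₀Y d ℓ hd hL b₀ b₁ Mstar ≤ (geo9Y x).M) (s₀ : BlkY x.toKIdx) :
    ((Finset.univ.filter fun s : BlkY x.toKIdx => distB x.toKIdx s₀ s ≤ 1).card : ℝ) ≤ nearBlkCntY d ℓ hd hL b₀ b₁ Mstar :=
  (exists_card_nearBlocks_le (d := d) (ℓ := ℓ) (hd := hd) (hL := hL) (b₀ := b₀) (b₁ := b₁) (Mstar := Mstar)).choose_spec.choose_spec.2 x hM s₀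

/-- `walkCntY ≥ 0`. [cite: Balaban1984PropagatorsII, p.235, bookkeeping] -/
theorem walkCntY_nonneg : 0 ≤ walkCntY d ℓ hd hL b₀ b₁ Mstar := by
  unfold walkCntY; exact mul_nonneg (by positivity) nearBlkCntY_nonneg

end Count

/-! ## §3 The static facts -/

section Static

variable (x : MemberY d ℓ hd hL b₀ b₁ Mstar)

/-- ★ **`|h_□| ≤ 1` on the coordinate carrier** (`StaticOK.hh ∕ hhY`). [cite: Balaban1984PropagatorsII, (2.36) p.229 («0 ≦ h_□ ≦ 1»); Balaban1985BackgroundPropagators, p.408] -/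
theorem abs_hWalkY_le_one (c : ↥(cubes x.toKIdx.D.toDomains)) (p : XSK κ x.toKIdx) : |hWalkY x c p| ≤ 1 :=
  abs_hT_le_one x.toKIdx.D (one_le_Mh_and_P x.toKIdx).1 (one_le_Mh_and_P x.toKIdx).2 c p.1

/-- **`Σ_□ h_□² = 1` on the coordinate carrier.** [cite: Balaban1985BackgroundPropagators, p.408; Balaban1984PropagatorsII, (2.36) p.229] -/
theorem sum_hWalkY_sq (p : XSK κ x.toKIdx) : ∑ c, hWalkY x c p ^ 2 = 1 :=
  sum_hT_sq x.toKIdx.D (one_le_Mh_and_P x.toKIdx).1 (one_le_Mh_and_P x.toKIdx).2 p.1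

/-- a site where `h_□ ≠ 0` lies in `□̃(c)`. [cite: Balaban1984PropagatorsII, p.235, (2.134) p.247, bookkeeping] -/
theorem mem_cubeDomY_of_hTY_ne_zero (c : ↥(cubes x.toKIdx.D.toDomains)) {z : SiteY x.toKIdx} (h : hTY x.toKIdx c z ≠ 0) : z ∈ cubeDomY x c := by
  unfold cubeDomY cubeBlksY
  rw [Finset.mem_filter]
  exact ⟨Finset.mem_univ _, QT_subset_QbigT _ _ c (blkOf_mem_QT_of_hT_ne_zero (two_le_Mh x) (two_L_le_R x) (four_le_P x) c h)⟩

/-- ★ **`h_□ ≠ 0` at a point ⟹ its block lies in `S_□`** (`StaticOK.hS ∕ hSY` at the site pins `blk = blkY = blkSK (sIK bI)`).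
[cite: Balaban1985BackgroundPropagators, p.408–409; Balaban1984PropagatorsII, p.235, (2.134) p.247] -/
theorem blkSK_mem_SblkY_of_hWalkY_ne_zero (bI : FBondY x.toKIdx → IBondY x.toKIdx) (c : ↥(cubes x.toKIdx.D.toDomains)) {p : XSK κ x.toKIdx}
    (h : hWalkY x c p ≠ 0) : blkSK x.toKIdx (sIK x.toKIdx bI) p ∈ SblkY x bI c :=
  Finset.mem_image_of_mem _ (mem_cubeDomY_of_hTY_ne_zero x c h)

/-- ★★ **THE MEMBER-UNIFORM OVERLAP COUNT `Σ_□ 1_{S_□}(y) ≤ N`** (`StaticOK.cnt` at a 1-faithful block map, above the named threshold): the cubes `c` with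
`y ∈ S_□(c)` are among those whose `□̃` contains a block within block distance 1 of the carrier block `β y`.
[cite: Balaban1984PropagatorsII, p.235 («the cubes overlap finitely often»), (2.45)–(2.46) p.231, Lemma 2.1 (2.61) p.234; Balaban1985BackgroundPropagators, p.409] -/
theorem sum_indicator_SblkY_le (bI : FBondY x.toKIdx → IBondY x.toKIdx)
    (hβ1 : ∀ f : FBondY x.toKIdx, (B6Geom246MultiLevelTorus.geomT x.D).dist (β x.hN x.D x.hk (bI f)) (blkV1 x.hN x.D f) ≤ 1)
    (hM : walkCntM₀Y d ℓ hd hL b₀ b₁ Mstar ≤ (geo9Y x).M) (y : IBondY x.toKIdx) :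
    (∑ c : ↥(cubes x.toKIdx.D.toDomains), (if y ∈ SblkY x bI c then (1 : ℝ) else 0)) ≤ walkCntY d ℓ hd hL b₀ b₁ Mstar := by
  classical
  rw [Finset.sum_boole]
  -- the near blocks of `β y` and, for each, the cubes whose `□̃` contains it
  set N : Finset (BlkY x.toKIdx) := Finset.univ.filter fun s => distB x.toKIdx (β x.hN x.D x.hk y) s ≤ 1 with hN
  set T : BlkY x.toKIdx → Finset ↥(cubes x.toKIdx.D.toDomains) := fun a => Finset.univ.filter fun c => a ∈ cubeBlksY x c with hT
  have hsub : (Finset.univ.filter fun c : ↥(cubes x.toKIdx.D.toDomains) => y ∈ SblkY x bI c) ⊆ N.biUnion T := by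
    intro c hc
    rw [Finset.mem_filter] at hc
    obtain ⟨z, hz, hzy⟩ := Finset.mem_image.1 hc.2
    have hzb : blkOf x.toKIdx.D.toDomains z ∈ cubeBlksY x c := by
      unfold cubeDomY at hz; exact (Finset.mem_filter.1 hz).2
    refine Finset.mem_biUnion.2 ⟨blkOf x.toKIdx.D.toDomains z, ?_, ?_⟩
    · rw [hN, Finset.mem_filter]; exact ⟨Finset.mem_univ _, distB_blkOf_le_one_of_sIK x hβ1 hzy⟩
    · rw [hT, Finset.mem_filter]; exact ⟨Finset.mem_univ _, hzb⟩
  have h1 : ((Finset.univ.filter fun c : ↥(cubes x.toKIdx.D.toDomains) => y ∈ SblkY x bI c).card : ℝ) ≤ ((N.biUnion T).card : ℝ) := by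
    exact_mod_cast Finset.card_le_card hsub
  have h2 : ((N.biUnion T).card : ℝ) ≤ ∑ a ∈ N, ((T a).card : ℝ) := by
    exact_mod_cast Finset.card_biUnion_le
  have h3 : ∀ a ∈ N, ((T a).card : ℝ) ≤ 3 * 9 ^ (d + 1) := fun a _ => by
    rw [hT]
    exact_mod_cast card_filter_mem_QbigT_le (D := x.toKIdx.D) hL (two_le_Mh x) x.toKIdx.hR2 (one_le_Mh_and_P x.toKIdx).1 (four_le_P x) a
  have h4 : ∑ a ∈ N, ((T a).card : ℝ) ≤ (N.card : ℝ) * (3 * 9 ^ (d + 1)) := by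
    have := Finset.sum_le_sum h3
    rwa [Finset.sum_const, nsmul_eq_mul] at this
  have h5 : (N.card : ℝ) ≤ nearBlkCntY d ℓ hd hL b₀ b₁ Mstar := by rw [hN]; exact card_nearBlocks_le x hM _
  calc ((Finset.univ.filter fun c : ↥(cubes x.toKIdx.D.toDomains) => y ∈ SblkY x bI c).card : ℝ)
      ≤ (N.card : ℝ) * (3 * 9 ^ (d + 1)) := h1.trans (h2.trans h4)
    _ ≤ nearBlkCntY d ℓ hd hL b₀ b₁ Mstar * (3 * 9 ^ (d + 1)) := mul_le_mul_of_nonneg_right h5 (by positivity)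
    _ = walkCntY d ℓ hd hL b₀ b₁ Mstar := by unfold walkCntY; ring

/-- ★ **`G′_□` KILLS INPUTS OFF `□̃(c)`** — through the model: if `f` and `f′` agree at every coordinate point whose site lies in `□̃(c)`, then
`gsqcoS … c U f = gsqcoS … c U f′` wherever read (FILE A's `GsqY_apply_congr`; the support half of `Locality.gsq`).
[cite: Balaban1985BackgroundPropagators, p.410 («G′_□ depends on U restricted to Ω₀(□) ⊂ □̃⁵»); Balaban1984PropagatorsII, (2.37) p.229] -/
theorem gsqcoS_apply_eq_zero_off [Fintype κ] {𝔸 : Type} [NormedRing 𝔸] [NormedAlgebra ℂ 𝔸] [CompleteSpace 𝔸] [FiniteDimensional ℝ 𝔸]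
    (b : Module.Basis κ ℝ 𝔸) (B : B9.Backgrounds) (cfg : B.Cfg → CfgY 𝔸 x.toKIdx) (parS : SiteParY 𝔸 x.toKIdx) (c : ↥(cubes x.toKIdx.D.toDomains))
    (U : B.Cfg) (f : XSK κ x.toKIdx → ℝ) {p : XSK κ x.toKIdx} (hp : p.1 ∉ cubeDomY x c) : gsqcoS x b B cfg parS c U f p = 0 := by
  show ((etaS x.toKIdx ^ 2 * B9Thm39ReadingCoords.cR39 b) •
      coordOpK b (fun _ : Fin (d + 1) => (GsqY x.toKIdx parS (cubeDomY x c) (cfg U)).restrictScalars ℝ)) f p = 0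
  rw [LinearMap.smul_apply, Pi.smul_apply, B9CoReadingCoords.coordOpK_apply, LinearMap.restrictScalars_apply,
    GsqY_apply_eq_zero x.toKIdx parS (cfg U) _ hp, map_zero, Finsupp.zero_apply, smul_zero]

end Static

end Literature.MathematicalPhysics.QuantumFieldTheory.Balaban1983to89.B9WalkLettersCoordsS

end
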